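import Literature.Computability.MetaComplexity.HeuristicClassesProofs
import Literature.Computability.MetaComplexity.HeuristicClassesReductionProofs
import Literature.Computability.Complexity.MapFstMachine
import HarnessLib

/-!
# `HeurBPP` is closed under heuristic polynomial-time reductions (proofs)

Fourth sibling proof file of `HeuristicClasses.lean` (D-0014: named facts `def X : Prop` are
discharged as `theorem X_holds : X`; the third sibling, `HeuristicClassesReductionProofs.lean`,
discharges the deterministic case `mem_AvgP_of_polyTimeReducible` and its domination lemma
`toOuterMeasure_setOf_apply_mem_le_of_dominated` is reused here). This file discharges

* `Literature.Computability.MetaComplexity.mem_HeurBPP_of_polyTimeReducible_holds :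
  mem_HeurBPP_of_polyTimeReducible` — if `Q₁ ≤_{AvgP} Q₂` (`DistProblem.PolyTimeReducible`, a
  deterministic heuristic polynomial-time reduction of Bogdanov–Trevisan) and `Q₂ ∈ HeurBPP`,
  then `Q₁ ∈ HeurBPP`.

## The printed proof and what is proved here

Bogdanov–Trevisan (2006), Lemma 3.2 (arXiv:cs/0606037v3, Lemma 18, p. 24): "If
`(L, D) ≤_{AvgP} (L', D')` and `(L', D') ∈ C`, where `C` is one of the distributional classes
`AvgP, Avg_neg P, HeurP, Heur_neg P, AvgBPP, HeurBPP, AvgP/poly, HeurP/poly`, then `(L, D) ∈ C`."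
The printed proof treats `C = AvgP` ("the same proof works for all the other cases"): with `f`
the reduction and `p`, `m` the polynomials of the domination condition, the new scheme is
`A(x; n, δ) := A'(f(x; n); m(n), δ / p(n))`, and for the set `B` of bad instances of `A'` at
parameters `(m(n), δ/p(n))`,
`Pr_{x ∼ Dₙ}[f(x; n) ∈ B] = Σ_{y ∈ B} Σ_{f(x;n) = y} Dₙ(x) ≤ p(n) · D'_{m(n)}(B) ≤ δ`.

For `C = HeurBPP` the bad set is `B = {y | Pr_coins[A'(y; m(n), δ') ≠ L'(y)] ≥ 1/4}` and the
argument is the same, *provided* the randomized algorithm `A` on `x` has exactly the output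
distribution of `A'` on `f(x; n)`. In the tree's model of probabilistic machines
(`Complexity.RandAlg`: a deterministic `run input coins` with a coin *budget* `coinLen` that is a
function of the encoded input length only, required by `RandAlg.IsPolyTime` to be polynomially
*bounded* but otherwise arbitrary, the `HeurBPP` guarantee of `A'` concerning coin strings of
length exactly `coinLen |⟨y, 1^{m(n)}, 1^{k'}⟩|`), this proviso is arranged by **padding the
failure parameter**: the new algorithm runs `A'` on `⟨f(x;n), 1^{m(n)}, 1^{K}⟩` with
`K := G(N) − |⟨f(x;n), 1^{m(n)}, 1⁰⟩|`, where `N = |⟨x, 1ⁿ, 1ᵏ⟩|` and `G` is a large polynomial,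
so that the new instance has length exactly `G(N)`; the coin budget of the new algorithm is then
`N ↦ coinLen (G N)` and its output distribution on `(x, n, k)` *is* that of `A'` on the padded
instance (`outputPMF_redAlg`), with no assumption on `coinLen` beyond the polynomial bound.
A larger failure parameter only sharpens the guarantee of `A'` (`≤ 1/K ≤ 1/(k p(n))`), but `K`
now varies with `x` (through `|x|` and `|f(x; n)|`), so the bad inputs of the new algorithm are
covered by the family of bad sets `B(κ(ℓ, ℓ'))` of `A'` indexed by `ℓ = |x|`, `ℓ' = |f(x; n)|`;
choosing `G = 2q + 2m + 5 + p · (X+2)² · (q+2)²` (`q` an output-length bound of `f`) gives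
`p(n) / κ(ℓ, ℓ') ≤ 1 / ((ℓ+k+1)(ℓ+k+2)(ℓ'+1)(ℓ'+2))`, and the double series telescopes to
`1/(k+1) · 1 ≤ 1/k`. The domination step `Pr_{Dₙ}[f(x;n) ∈ T] ≤ p(n) · D'_{m(n)}(T)` (the
displayed computation of the printed proof, for an arbitrary set `T`) is
`toOuterMeasure_setOf_apply_mem_le_of_dominated` of the third sibling file. (In the deterministic
case no padding is needed and the third sibling takes `K = K(n, k)`; for randomized schemes the
coin budget forces `K` to depend on `|x|` and `|f(x;n)|` as above.)

Polynomial time: the instance map `⟨x, 1ⁿ, 1ᵏ⟩ ↦ ⟨f(x;n), 1^{m(n)}, 1^{K}⟩` is assembled in the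
tree's algebra of total `FP` string functions (`Brick.fstF`/`sndF`, `fanoutFn`, `Plumb.polyFn`,
`Plumb.dropFn`, `onesFn`; the reduction `f`, specified on `paramEnc`, is made total through the
normaliser `w ↦ ⟨(boolUnpair w).1, 1^{|(boolUnpair w).2|}⟩` as in `SchemeEncBricks.lean`), lifted
to pairs `⟨instance, coins⟩` by `mapFstFn_mem_FP` (`MapFstMachine.lean`), and composed with the
machine of `A'` (`PolyTimeComputable.comp_holds`).

## References

* A. Bogdanov, L. Trevisan, *Average-Case Complexity*, Found. Trends TCS 2 (2006), §3.1,
  Def. 3.1 (reductions, domination) and Lemma 3.2 (closure of the average-case classes under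
  reductions); arXiv:cs/0606037v3, Def. 17 and Lemma 18 (pp. 23–24), Def. 14–15 (`HeurBPP`, p. 19).
* L. Levin, *Average case complete problems*, SIAM J. Comput. 15 (1986), 285–286.
* S. Arora, B. Barak, *Computational Complexity: A Modern Approach*, CUP 2009, §1.3 (closure of
  polynomial time under composition), §0.1 (pairing), Def. 7.1/7.3 (coins of a PTM).
-/

namespace Literature.Computability.MetaComplexity

open _root_.Computability Complexity Complexity.Brick
open scoped ENNReal

/-! ### Lengths of the encodings -/

/-- `|1ⁿ| = n` (Mathlib's unary numeral; private copy of the namesake of `FregeProofs.lean`,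
whose import closure is not wanted here). [folklore] -/
private theorem length_unaryEncodeNat' (n : ℕ) : (unaryEncodeNat n).length = n := by
  rw [OracleCompose.unaryEncodeNat_eq_replicate, List.length_replicate]

/-- `|⟨x, 1ⁿ⟩| = 2|x| + n + 2`. [Bogdanov–Trevisan 2006, §2.1; Arora–Barak 2009, §0.1]
[cite: AroraBarak2009, §0.1] -/
theorem length_paramEnc (x : List Bool) (n : ℕ) :
    (paramEnc (x, n)).length = 2 * x.length + n + 2 := by
  simp only [paramEnc, length_boolPair, length_unaryEncodeNat']
  omega

/-- `|⟨x, ⟨1ⁿ, 1ᵏ⟩⟩| = 2|x| + 2n + k + 4`. [Bogdanov–Trevisan 2006, Def. 2.4; Arora–Barak 2009,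
§0.1] [cite: AroraBarak2009, §0.1] -/
theorem length_schemeEnc (x : List Bool) (n k : ℕ) :
    (schemeEnc (x, n, k)).length = 2 * x.length + 2 * n + k + 4 := by
  simp only [schemeEnc, length_boolPair, length_unaryEncodeNat']
  omega

/-- **Polynomial output length of a polynomial-time function** (general encoders): the encoded
output has length at most `q(|encoded input|)` for the polynomial `q = X + D · p` (`p` the time
polynomial, `D` the push bound of the machine; `OutputsWithin.length_le`).
[Arora–Barak 2009, §1.3] [cite: AroraBarak2009, §1.3] -/
theorem _root_.Literature.Computability.Complexity.PolyTimeComputable.exists_length_le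
    {α β Γ₀ Γ₁ : Type} {ea : α → List Γ₀} {eb : β → List Γ₁} {g : α → β}
    (hg : PolyTimeComputable ea eb g) :
    ∃ q : Polynomial ℕ, ∀ a, (eb (g a)).length ≤ q.eval (ea a).length := by
  obtain ⟨p, M, hM⟩ := hg
  refine ⟨Polynomial.X + Polynomial.C (TM2Comp.machinePushBound M.tm) * p, fun a => ?_⟩
  have h := (hM a).length_le
  simpa using h

/-! ### The padded instance map -/

section InstanceMap

variable (f : List Bool → ℕ → List Bool) (m G : Polynomial ℕ)

/-- The padded failure parameter `K(x, n, k) = G(|⟨x, 1ⁿ, 1ᵏ⟩|) − |⟨f(x;n), 1^{m(n)}, 1⁰⟩|`, chosen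
so that the new instance `⟨f(x;n), 1^{m(n)}, 1^{K}⟩` has length exactly `G(|⟨x, 1ⁿ, 1ᵏ⟩|)`.
[Bogdanov–Trevisan 2006, Lemma 3.2 (proof: failure parameter `δ/p(n)`), here padded]
[cite: BogdanovTrevisan2006, Lemma 3.2 (proof)] -/
def redParam (x : List Bool) (n k : ℕ) : ℕ :=
  G.eval (schemeEnc (x, n, k)).length - (schemeEnc (f x n, m.eval n, 0)).length

/-- The instance map of the new scheme: `(x, n, k) ↦ (f(x; n), m(n), K(x, n, k))`.
[Bogdanov–Trevisan 2006, Lemma 3.2 (proof: `A(x; n, δ) := A'(f(x;n); m(n), δ/p(n))`)]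
[cite: BogdanovTrevisan2006, Lemma 3.2 (proof)] -/
def redMap (q : List Bool × ℕ × ℕ) : List Bool × ℕ × ℕ :=
  (f q.1 q.2.1, m.eval q.2.1, redParam f m G q.1 q.2.1 q.2.2)

/-- **The padded instance has length exactly `G(N)`**, provided `G(N)` is at least the length of
the unpadded instance. [folklore] -/
theorem length_schemeEnc_redMap {f m G} (x : List Bool) (n k : ℕ)
    (hG : (schemeEnc (f x n, m.eval n, 0)).length ≤ G.eval (schemeEnc (x, n, k)).length) :
    (schemeEnc (redMap f m G (x, n, k))).length = G.eval (schemeEnc (x, n, k)).length := by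
  simp only [redMap, redParam, length_schemeEnc] at hG ⊢
  omega

/-! #### The instance map as a total `FP` string function -/

/-- The reduction as a total string function: `totF f w = f (boolUnpair w).1 |(boolUnpair w).2|`
(so `totF f ⟨x, 1ⁿ⟩ = f(x; n)`). [folklore] -/
def totF (w : List Bool) : List Bool := f (fstF w) (sndF w).length

/-- On a well-formed word `⟨x, u⟩`, `totF f` is `f (x; |u|)`. [folklore] -/
@[simp] theorem totF_boolPair (x u : List Bool) : totF f (boolPair x u) = f x u.length := by
  simp [totF]

/-- The normaliser `w ↦ ⟨(boolUnpair w).1, 1^{|(boolUnpair w).2|}⟩ = paramEnc (decoding of w)` is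
polynomial time into the parameter encoding (bricks `fanoutFn`, `fstF`, `onesFn ∘ sndF`).
[Arora–Barak 2009, §1.3] [folklore] -/
theorem polyTimeComputable_decParam :
    PolyTimeComputable (id : List Bool → List Bool) paramEnc
      fun w : List Bool => (fstF w, (sndF w).length) := by
  obtain ⟨p, M, hM⟩ := fanoutFn_mem_FP fstF_mem_FP (comp_mem_FP onesFn_mem_FP sndF_mem_FP)
  refine ⟨p, M, fun w => ?_⟩
  have h := hM w
  have heq : (id (fanoutFn fstF (onesFn ∘ sndF) w) : List Bool) =
      paramEnc (fstF w, (sndF w).length) := by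
    simp [fanoutFn_apply, paramEnc, onesFn]
  rw [heq] at h
  exact h

/-- **The total reduction is in `FP`** when `f` is polynomial time on `paramEnc`
(`PolyTimeComputable.comp_holds` with the normaliser). [Arora–Barak 2009, §1.3] [folklore] -/
theorem totF_mem_FP {f} (hf : PolyTimeComputable paramEnc (id : List Bool → List Bool) (Function.uncurry f)) :
    totF f ∈ FP := by
  have h := PolyTimeComputable.comp_holds hf (polyTimeComputable_decParam)
  exact h

/-- The first string component of the instance map: `w ↦ f(x; n)` on `w = ⟨x, ⟨1ⁿ, 1ᵏ⟩⟩`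
(`totF f` after re-pairing `x` with `1ⁿ`). [folklore] -/
noncomputable def yF : List Bool → List Bool := totF f ∘ fanoutFn fstF (fstF ∘ sndF)

/-- The second component: `w ↦ 1^{m(n)}` (`Plumb.polyFn m` on the field `1ⁿ`). [folklore] -/
noncomputable def mF : List Bool → List Bool := Plumb.polyFn m ∘ fstF ∘ sndF

/-- The unpadded instance `w ↦ ⟨f(x;n), ⟨1^{m(n)}, 1⁰⟩⟩`. [folklore] -/
noncomputable def s0F : List Bool → List Bool := fanoutFn (yF f) (fanoutFn (mF m) fun _ => [])

/-- The padded failure parameter in unary: `w ↦ 1^{G(|w|) − |s0F w|}` (`Plumb.dropFn`). [folklore] -/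
noncomputable def kF : List Bool → List Bool := Plumb.dropFn ∘ fanoutFn (s0F f m) (Plumb.polyFn G)

/-- The instance map as a total string function: `w ↦ ⟨f(x;n), ⟨1^{m(n)}, 1^{K}⟩⟩`. [folklore] -/
noncomputable def psiF : List Bool → List Bool := fanoutFn (yF f) (fanoutFn (mF m) (kF f m G))

/-- `yF` computes `f(x; n)` on scheme words. [folklore] -/
theorem yF_schemeEnc (x : List Bool) (n k : ℕ) : yF f (schemeEnc (x, n, k)) = f x n := by
  simp [yF, schemeEnc, length_unaryEncodeNat']

/-- `mF` computes `1^{m(n)}` on scheme words. [folklore] -/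
theorem mF_schemeEnc (x : List Bool) (n k : ℕ) :
    mF m (schemeEnc (x, n, k)) = unaryEncodeNat (m.eval n) := by
  simp [mF, schemeEnc, OracleCompose.unaryEncodeNat_eq_replicate, ones]

/-- `s0F` computes the unpadded instance on scheme words. [folklore] -/
theorem s0F_schemeEnc (x : List Bool) (n k : ℕ) :
    s0F f m (schemeEnc (x, n, k)) = schemeEnc (f x n, m.eval n, 0) := by
  rw [s0F, fanoutFn_apply, fanoutFn_apply, yF_schemeEnc, mF_schemeEnc]
  rfl

/-- `kF` computes the padded failure parameter in unary on scheme words. [folklore] -/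
theorem kF_schemeEnc (x : List Bool) (n k : ℕ) :
    kF f m G (schemeEnc (x, n, k)) = unaryEncodeNat (redParam f m G x n k) := by
  rw [kF, Function.comp_apply, fanoutFn_apply, Plumb.dropFn_boolPair, Plumb.polyFn_apply,
    s0F_schemeEnc, OracleCompose.unaryEncodeNat_eq_replicate, List.drop_replicate]
  rfl

/-- **`psiF` is the instance map on scheme words**: `psiF ⟨x, 1ⁿ, 1ᵏ⟩ = ⟨redMap (x, n, k)⟩`.
[folklore] -/
theorem psiF_schemeEnc (x : List Bool) (n k : ℕ) :
    psiF f m G (schemeEnc (x, n, k)) = schemeEnc (redMap f m G (x, n, k)) := by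
  rw [psiF, fanoutFn_apply, fanoutFn_apply, yF_schemeEnc, mF_schemeEnc, kF_schemeEnc]
  rfl

/-- `psiF ∈ FP` (closure of `FP` under composition and fan-out; leaves `totF_mem_FP`,
`Plumb.polyFn_mem_FP`, `Plumb.dropFn_mem_FP`, projections, constants).
[Arora–Barak 2009, §1.3] [folklore] -/
theorem psiF_mem_FP {f} (hf : PolyTimeComputable paramEnc (id : List Bool → List Bool) (Function.uncurry f)) :
    psiF f m G ∈ FP := by
  have hy : yF f ∈ FP :=
    comp_mem_FP (totF_mem_FP hf) (fanoutFn_mem_FP fstF_mem_FP (comp_mem_FP fstF_mem_FP sndF_mem_FP))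
  have hm : mF m ∈ FP :=
    comp_mem_FP (Plumb.polyFn_mem_FP m) (comp_mem_FP fstF_mem_FP sndF_mem_FP)
  have hs : s0F f m ∈ FP := fanoutFn_mem_FP hy (fanoutFn_mem_FP hm (const_mem_FP []))
  have hk : kF f m G ∈ FP :=
    comp_mem_FP Plumb.dropFn_mem_FP (fanoutFn_mem_FP hs (Plumb.polyFn_mem_FP G))
  exact fanoutFn_mem_FP hy (fanoutFn_mem_FP hm hk)

/-- **The instance map on pairs `⟨instance, coins⟩` is polynomial time** with respect to the
encoding `boolPair (schemeEnc ·) ·` of `RandAlg.IsPolyTime`: it is `mapFstFn psiF`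
(`mapFstFn_mem_FP`) read through the encoders (`PolyTimeComputable.of_comp_encode`).
[Arora–Barak 2009, Thm. 2.8 (proof), §1.3] [folklore] -/
theorem polyTimeComputable_redMap_pair {f}
    (hf : PolyTimeComputable paramEnc (id : List Bool → List Bool) (Function.uncurry f)) :
    PolyTimeComputable (fun p : (List Bool × ℕ × ℕ) × List Bool => boolPair (schemeEnc p.1) p.2)
      (fun p : (List Bool × ℕ × ℕ) × List Bool => boolPair (schemeEnc p.1) p.2)
      fun p : (List Bool × ℕ × ℕ) × List Bool => (redMap f m G p.1, p.2) := by
  have hg : PolyTimeComputable (id : List Bool → List Bool) id (mapFstFn (psiF f m G)) :=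
    mapFstFn_mem_FP (psiF_mem_FP m G hf)
  exact hg.of_comp_encode (fun p => boolPair (schemeEnc p.1) p.2) (fun _ => rfl)
    (fun p => by
      obtain ⟨⟨x, n, k⟩, r⟩ := p
      simp only [id, mapFstFn_boolPair, psiF_schemeEnc])

end InstanceMap

/-! ### The new randomized scheme -/

section RedAlg

variable (f : List Bool → ℕ → List Bool) (m G : Polynomial ℕ)

/-- The new randomized heuristic scheme: run `A` on the padded instance with the *same* coin
string, the coin budget being read off the padded length `G(N)`:
`run (x, n, k) r := A.run (redMap (x, n, k)) r`, `coinLen N := A.coinLen (G N)`.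
[Bogdanov–Trevisan 2006, Lemma 3.2 (proof)] [cite: BogdanovTrevisan2006, Lemma 3.2 (proof)] -/
def redAlg (A : RandAlg (List Bool × ℕ × ℕ) Bool) : RandAlg (List Bool × ℕ × ℕ) Bool where
  run q r := A.run (redMap f m G q) r
  coinLen N := A.coinLen (G.eval N)

/-- Push-forwards of uniform coin strings of equal (propositionally, not definitionally) lengths
agree. [folklore] -/
theorem map_uniformOfFintype_vector_congr {β : Type} {c c' : ℕ} (h : c = c') (g : List Bool → β) :
    (PMF.uniformOfFintype (List.Vector Bool c)).map (fun r => g r.toList) =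
      (PMF.uniformOfFintype (List.Vector Bool c')).map (fun r => g r.toList) := by
  subst h
  rfl

/-- **Output distribution of the new scheme**: on `(x, n, k)` it is the output distribution of
`A` on the padded instance (same run, same number of coins since the padded instance has length
exactly `G(N)`). [Bogdanov–Trevisan 2006, Lemma 3.2 (proof)]
[cite: BogdanovTrevisan2006, Lemma 3.2 (proof)] -/
theorem outputPMF_redAlg {f m G} (A : RandAlg (List Bool × ℕ × ℕ) Bool) (x : List Bool) (n k : ℕ)
    (hG : (schemeEnc (f x n, m.eval n, 0)).length ≤ G.eval (schemeEnc (x, n, k)).length) :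
    (redAlg f m G A).outputPMF schemeEnc (x, n, k) =
      A.outputPMF schemeEnc (redMap f m G (x, n, k)) := by
  simp only [RandAlg.outputPMF, redAlg]
  exact map_uniformOfFintype_vector_congr (by rw [length_schemeEnc_redMap x n k hG])
    (A.run (redMap f m G (x, n, k)))

/-- Probabilities of events under the new scheme are those of `A` on the padded instance.
[Bogdanov–Trevisan 2006, Lemma 3.2 (proof)] [cite: BogdanovTrevisan2006, Lemma 3.2 (proof)] -/
theorem pr_redAlg {f m G} (A : RandAlg (List Bool × ℕ × ℕ) Bool) (x : List Bool) (n k : ℕ)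
    (hG : (schemeEnc (f x n, m.eval n, 0)).length ≤ G.eval (schemeEnc (x, n, k)).length)
    (E : Set Bool) :
    (redAlg f m G A).pr schemeEnc (x, n, k) E = A.pr schemeEnc (redMap f m G (x, n, k)) E := by
  simp only [RandAlg.pr, outputPMF_redAlg A x n k hG]

/-- **The new scheme is polynomial time**: compose the machine of `A` after the instance map on
pairs (`PolyTimeComputable.comp_holds`); the coin bound is `p_A ∘ G`.
[Arora–Barak 2009, Thm. 2.8 (proof), §1.3] [folklore] -/
theorem isPolyTime_redAlg {f} {A : RandAlg (List Bool × ℕ × ℕ) Bool}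
    (hf : PolyTimeComputable paramEnc (id : List Bool → List Bool) (Function.uncurry f))
    (hA : A.IsPolyTime schemeEnc encodeBool) : (redAlg f m G A).IsPolyTime schemeEnc encodeBool := by
  obtain ⟨pA, hpA⟩ := hA.2
  refine ⟨PolyTimeComputable.comp_holds hA.1 (polyTimeComputable_redMap_pair m G hf),
    pA.comp G, fun N => ?_⟩
  rw [Polynomial.eval_comp]
  exact hpA _

end RedAlg

/-! ### Probability bookkeeping -/

/-- A `PMF` outer measure is finite. [Mathlib `PMF.tsum_coe_indicator_ne_top`] [folklore] -/
theorem toOuterMeasure_ne_top' {α : Type} (D : PMF α) (E : Set α) : D.toOuterMeasure E ≠ ∞ := by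
  rw [PMF.toOuterMeasure_apply]
  exact D.tsum_coe_indicator_ne_top E

/-- The real-valued bound `Pr_{x ∼ Dₙ}[E] ≤ 1/K` of the class conditions, in `ℝ≥0∞`:
`Dₙ(E) ≤ K⁻¹`. [folklore] -/
theorem toOuterMeasure_le_inv_of_prob_le {D : Ensemble} {n K : ℕ} {E : Set (List Bool)}
    (hK : 0 < K) (h : D.prob n E ≤ 1 / K) : (D n).toOuterMeasure E ≤ ((K : ℕ) : ℝ≥0∞)⁻¹ := by
  rw [← ENNReal.ofReal_toReal (toOuterMeasure_ne_top' (D n) E)]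
  calc ENNReal.ofReal ((D n).toOuterMeasure E).toReal
      ≤ ENNReal.ofReal (1 / K) := ENNReal.ofReal_le_ofReal h
    _ = ((K : ℕ) : ℝ≥0∞)⁻¹ := by
        rw [one_div, ENNReal.ofReal_inv_of_pos (by exact_mod_cast hK), ENNReal.ofReal_natCast]

/-! ### The telescoping series `Σ_j 1/((j+c+1)(j+c+2)) = 1/(c+1)` -/

/-- Partial sums of the telescoping series: `Σ_{j<L} 1/((j+c+1)(j+c+2)) + 1/(L+c+1) = 1/(c+1)`.
[folklore] -/
theorem sum_range_inv_mul_succ (c L : ℕ) :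
    ∑ j ∈ Finset.range L, (((j + c + 1) * (j + c + 2) : ℕ) : ℝ≥0∞)⁻¹ +
        (((L + c + 1 : ℕ)) : ℝ≥0∞)⁻¹ = (((c + 1 : ℕ)) : ℝ≥0∞)⁻¹ := by
  induction L with
  | zero => simp
  | succ L ih =>
    rw [Finset.sum_range_succ, add_assoc, ← ih]
    congr 1
    -- `1/((L+c+1)(L+c+2)) + 1/(L+c+2) = 1/(L+c+1)`, checked in `ℝ`
    rw [← ENNReal.toReal_eq_toReal_iff' (by simp) (by simp)]
    rw [ENNReal.toReal_add (by simp) (by simp)]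
    simp only [ENNReal.toReal_inv, ENNReal.toReal_natCast]
    push_cast
    have h1 : ((L : ℝ) + c + 1) ≠ 0 := by positivity
    have h2 : ((L : ℝ) + c + 2) ≠ 0 := by positivity
    have h3 : ((L : ℝ) + 1 + c + 1) ≠ 0 := by positivity
    field_simp
    ring

/-- **`Σ_{j ≥ 0} 1/((j+c+1)(j+c+2)) ≤ 1/(c+1)`** (in `ℝ≥0∞`). [folklore] -/
theorem tsum_inv_mul_succ_le (c : ℕ) :
    ∑' j : ℕ, (((j + c + 1) * (j + c + 2) : ℕ) : ℝ≥0∞)⁻¹ ≤ (((c + 1 : ℕ)) : ℝ≥0∞)⁻¹ :=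
  ENNReal.tsum_le_of_sum_range_le fun L => by
    rw [← sum_range_inv_mul_succ c L]
    exact le_self_add

/-! ### The arithmetic of the padding polynomial -/

/-- The padding polynomial `G = 2q + 2m + 5 + p · (X+2)² · (q+2)²`. [folklore] -/
noncomputable def padPoly (p m q : Polynomial ℕ) : Polynomial ℕ :=
  2 * q + 2 * m + 5 + p * (Polynomial.X + 2) ^ 2 * (q + 2) ^ 2

/-- Evaluation of the padding polynomial. [folklore] -/
theorem padPoly_eval (p m q : Polynomial ℕ) (N : ℕ) :
    (padPoly p m q).eval N =
      2 * q.eval N + 2 * m.eval N + 5 + p.eval N * (N + 2) ^ 2 * (q.eval N + 2) ^ 2 := by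
  simp [padPoly]

/-- **The padding inequality.** For `ℓ' ≤ q(N)`, `n ≤ N`, `ℓ + k ≤ N` (where `N = 2ℓ + 2n + k + 4`
in the application), the padded failure parameter `κ = G(N) − (2ℓ' + 2m(n) + 4)` satisfies
`κ ≥ 1 + p(n) · (ℓ+k+1)(ℓ+k+2)(ℓ'+1)(ℓ'+2)`. [folklore] -/
theorem padParam_ge (p m q : Polynomial ℕ) {N n ℓ ℓ' k : ℕ} (hℓ' : ℓ' ≤ q.eval N) (hn : n ≤ N)
    (hℓk : ℓ + k ≤ N) :
    1 + p.eval n * ((ℓ + k + 1) * (ℓ + k + 2) * ((ℓ' + 1) * (ℓ' + 2))) ≤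
      (padPoly p m q).eval N - (2 * ℓ' + 2 * m.eval n + 4) := by
  rw [padPoly_eval]
  have hm : m.eval n ≤ m.eval N := polynomial_eval_mono m hn
  have hp : p.eval n ≤ p.eval N := polynomial_eval_mono p hn
  have h1 : (ℓ + k + 1) * (ℓ + k + 2) ≤ (N + 2) ^ 2 := by nlinarith
  have h2 : (ℓ' + 1) * (ℓ' + 2) ≤ (q.eval N + 2) ^ 2 := by nlinarith
  have h3 : p.eval n * ((ℓ + k + 1) * (ℓ + k + 2) * ((ℓ' + 1) * (ℓ' + 2))) ≤
      p.eval N * (N + 2) ^ 2 * (q.eval N + 2) ^ 2 := by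
    calc p.eval n * ((ℓ + k + 1) * (ℓ + k + 2) * ((ℓ' + 1) * (ℓ' + 2)))
        ≤ p.eval N * ((N + 2) ^ 2 * (q.eval N + 2) ^ 2) :=
          Nat.mul_le_mul hp (Nat.mul_le_mul h1 h2)
      _ = p.eval N * (N + 2) ^ 2 * (q.eval N + 2) ^ 2 := by ring
  omega

/-- The term estimate: if `κ ≥ 1 + P · M` with `M = (ℓ+k+1)(ℓ+k+2)(ℓ'+1)(ℓ'+2)`, then
`P · κ⁻¹ ≤ ((ℓ+k+1)(ℓ+k+2))⁻¹ · ((ℓ'+1)(ℓ'+2))⁻¹` in `ℝ≥0∞`. [folklore] -/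
theorem mul_inv_le_of_padParam_ge {P κ ℓ ℓ' k : ℕ}
    (hκ : 1 + P * ((ℓ + k + 1) * (ℓ + k + 2) * ((ℓ' + 1) * (ℓ' + 2))) ≤ κ) :
    (P : ℝ≥0∞) * ((κ : ℕ) : ℝ≥0∞)⁻¹ ≤
      (((ℓ + k + 1) * (ℓ + k + 2) : ℕ) : ℝ≥0∞)⁻¹ * (((ℓ' + 1) * (ℓ' + 2) : ℕ) : ℝ≥0∞)⁻¹ := by
  rcases Nat.eq_zero_or_pos P with hP | hP
  · simp [hP]
  set M : ℕ := (ℓ + k + 1) * (ℓ + k + 2) * ((ℓ' + 1) * (ℓ' + 2)) with hM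
  have hM0 : (M : ℝ≥0∞) ≠ 0 := by positivity
  have hMtop : (M : ℝ≥0∞) ≠ ∞ := ENNReal.natCast_ne_top M
  have hPM : ((P * M : ℕ) : ℝ≥0∞) ≤ (κ : ℝ≥0∞) := by exact_mod_cast (by omega : P * M ≤ κ)
  calc (P : ℝ≥0∞) * ((κ : ℕ) : ℝ≥0∞)⁻¹
      ≤ (P : ℝ≥0∞) * (((P * M : ℕ)) : ℝ≥0∞)⁻¹ := by gcongr
    _ = (M : ℝ≥0∞)⁻¹ := by
        rw [Nat.cast_mul, ENNReal.mul_inv (Or.inr hMtop) (Or.inl (ENNReal.natCast_ne_top P)),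
          ← mul_assoc, ENNReal.mul_inv_cancel (by exact_mod_cast hP.ne') (ENNReal.natCast_ne_top P),
          one_mul]
    _ = (((ℓ + k + 1) * (ℓ + k + 2) : ℕ) : ℝ≥0∞)⁻¹ * (((ℓ' + 1) * (ℓ' + 2) : ℕ) : ℝ≥0∞)⁻¹ := by
        rw [hM, Nat.cast_mul (m := (ℓ + k + 1) * (ℓ + k + 2)),
          ENNReal.mul_inv (Or.inl (by positivity)) (Or.inl (ENNReal.natCast_ne_top _))]

/-- Sets with equivalent membership have equal Boolean indicators (used with the correctness of
a reduction on the support: `f(x;n) ∈ L₂ ↔ x ∈ L₁`). [folklore] -/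
theorem boolIndicator_eq_of_iff {α β : Type*} {s : Set α} {t : Set β} {a : α} {b : β}
    (h : a ∈ s ↔ b ∈ t) : s.boolIndicator a = t.boolIndicator b := by
  rw [Bool.eq_iff_iff, ← Set.mem_iff_boolIndicator, ← Set.mem_iff_boolIndicator]
  exact h

/-! ### The discharge -/

/-- **`HeurBPP` is closed under heuristic polynomial-time reductions** (discharge of
`mem_HeurBPP_of_polyTimeReducible`). Given the reduction `f` (polynomial time on `⟨x, 1ⁿ⟩`,
correct on `supp D₁,ₙ`, dominated with polynomials `p`, `m`) and a randomized heuristic scheme `A`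
for `Q₂`, the scheme `redAlg f m G A` — run `A` on `⟨f(x;n), 1^{m(n)}, 1^{K}⟩` with the padded
failure parameter `K = G(N) − |⟨f(x;n), 1^{m(n)}, 1⁰⟩| ≥ 1 + p(n)(|x|+k+1)(|x|+k+2)(|f(x;n)|+1)(|f(x;n)|+2)`,
`G = padPoly p m q` — is polynomial time (`isPolyTime_redAlg`), has on `(x, n, k)` the output
distribution of `A` on the padded instance (`pr_redAlg`), and its bad inputs in `supp D₁,ₙ` are
covered by `⋃_{ℓ,ℓ'} {x : |x| = ℓ, |f(x;n)| = ℓ', f(x;n) ∈ B_A(m(n), κ(ℓ,ℓ'))}` (correctness on the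
support identifies the error events); by domination
(`toOuterMeasure_setOf_apply_mem_le_of_dominated`) and the
class condition of `A`, the piece `(ℓ, ℓ')` has `D₁,ₙ`-mass `≤ p(n)/κ(ℓ,ℓ') ≤
1/((ℓ+k+1)(ℓ+k+2)) · 1/((ℓ'+1)(ℓ'+2))` (empty if `ℓ' > q(N)`), and the double series is at most
`1/(k+1) · 1 ≤ 1/k` (`tsum_inv_mul_succ_le`). This is Bogdanov–Trevisan's proof of Lemma 3.2
("the same proof works for" `HeurBPP`), with the failure parameter `δ/p(n)` padded so that, in the
tree's `RandAlg` model (coin budget a function of the input length), the simulated run of `A`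
receives exactly its own number of coins.
[Bogdanov–Trevisan 2006, §3.1, Lemma 3.2 with Def. 3.1 (arXiv:cs/0606037v3, Lemma 18 and Def. 17,
pp. 23–24; `HeurBPP`: Def. 15, p. 19)] [cite: BogdanovTrevisan2006, Lemma 3.2] -/
theorem mem_HeurBPP_of_polyTimeReducible_holds : mem_HeurBPP_of_polyTimeReducible := by
  intro Q₁ Q₂ hred hQ₂
  obtain ⟨f, hf, hcorr, p, m, hdom⟩ := hred
  obtain ⟨A, hA, hbad⟩ := hQ₂
  -- output-length bound of the reduction
  obtain ⟨q, hq⟩ := hf.exists_length_le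
  have hq' : ∀ x n, (f x n).length ≤ q.eval (paramEnc (x, n)).length := fun x n => hq (x, n)
  set G : Polynomial ℕ := padPoly p m q with hGdef
  -- the padded parameter is large: `κ ≥ 1 + p(n)·(ℓ+k+1)(ℓ+k+2)(ℓ'+1)(ℓ'+2)`
  have hpad : ∀ (x : List Bool) (n k : ℕ),
      1 + p.eval n * ((x.length + k + 1) * (x.length + k + 2) *
          (((f x n).length + 1) * ((f x n).length + 2))) ≤ redParam f m G x n k ∧
        (schemeEnc (f x n, m.eval n, 0)).length ≤ G.eval (schemeEnc (x, n, k)).length := by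
    intro x n k
    have hN : (paramEnc (x, n)).length ≤ (schemeEnc (x, n, k)).length := by
      rw [length_paramEnc, length_schemeEnc]; omega
    have hℓ' : (f x n).length ≤ q.eval (schemeEnc (x, n, k)).length :=
      (hq' x n).trans (polynomial_eval_mono q hN)
    have hn : n ≤ (schemeEnc (x, n, k)).length := by rw [length_schemeEnc]; omega
    have hℓk : x.length + k ≤ (schemeEnc (x, n, k)).length := by rw [length_schemeEnc]; omega
    have key := padParam_ge p m q hℓ' hn hℓk
    have hlen0 : (schemeEnc (f x n, m.eval n, 0)).length = 2 * (f x n).length + 2 * m.eval n + 4 := by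
      rw [length_schemeEnc]
    refine ⟨?_, ?_⟩
    · rw [redParam, hlen0, hGdef]
      exact key
    · rw [hlen0, hGdef]
      omega
  refine ⟨redAlg f m G A, isPolyTime_redAlg m G hf hA, fun n k hk => ?_⟩
  -- notation
  set n' : ℕ := m.eval n with hn'
  set B₂ : ℕ → Set (List Bool) := fun K =>
    {y | 1 / 4 ≤ A.pr schemeEnc (y, n', K) {b | b ≠ Q₂.lang.boolIndicator y}} with hB₂
  set κ : ℕ → ℕ → ℕ := fun ℓ ℓ' =>
    G.eval (2 * ℓ + 2 * n + k + 4) - (2 * ℓ' + 2 * n' + 4) with hκ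
  set S : ℕ → ℕ → Set (List Bool) := fun ℓ ℓ' =>
    {x | x.length = ℓ ∧ (f x n).length = ℓ' ∧ f x n ∈ B₂ (κ ℓ ℓ')} with hS
  set B' : Set (List Bool) :=
    {x | 1 / 4 ≤ (redAlg f m G A).pr schemeEnc (x, n, k) {b | b ≠ Q₁.lang.boolIndicator x}}
    with hB'
  change Q₁.dist.prob n B' ≤ 1 / k
  -- the padded parameter of `x` is `κ |x| |f x n|`
  have hK : ∀ x, redParam f m G x n k = κ x.length (f x n).length := by
    intro x
    simp only [hκ, redParam, length_schemeEnc]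
    omega
  -- Step 1: bad inputs in the support are covered by the pieces `S ℓ ℓ'`
  have hcover : B' ∩ (Q₁.dist n).support ⊆ ⋃ ℓ, ⋃ ℓ', S ℓ ℓ' := by
    rintro x ⟨hx, hxs⟩
    simp only [Set.mem_iUnion]
    refine ⟨x.length, (f x n).length, rfl, rfl, ?_⟩
    have hind : Q₂.lang.boolIndicator (f x n) = Q₁.lang.boolIndicator x :=
      boolIndicator_eq_of_iff (hcorr n x hxs)
    change 1 / 4 ≤ A.pr schemeEnc (f x n, n', κ x.length (f x n).length)
      {b | b ≠ Q₂.lang.boolIndicator (f x n)}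
    rw [hind, ← hK x]
    have h := hx
    rw [Set.mem_setOf_eq, pr_redAlg A x n k (hpad x n k).2] at h
    exact h
  -- Step 2: each piece has small mass
  have hpiece : ∀ ℓ ℓ', (Q₁.dist n).toOuterMeasure (S ℓ ℓ') ≤
      (((ℓ + k + 1) * (ℓ + k + 2) : ℕ) : ℝ≥0∞)⁻¹ * (((ℓ' + 1) * (ℓ' + 2) : ℕ) : ℝ≥0∞)⁻¹ := by
    intro ℓ ℓ'
    by_cases hne : ∃ x, x.length = ℓ ∧ (f x n).length = ℓ'
    · obtain ⟨x₀, hx₀, hx₀'⟩ := hne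
      have hκx := (hpad x₀ n k).1
      rw [hK x₀, hx₀, hx₀'] at hκx
      have hκpos : 0 < κ ℓ ℓ' := by omega
      -- domination, then the class condition of `A` at `(n', κ ℓ ℓ')`
      have hsub : S ℓ ℓ' ⊆ {x | f x n ∈ B₂ (κ ℓ ℓ')} := fun x hx => hx.2.2
      calc (Q₁.dist n).toOuterMeasure (S ℓ ℓ')
          ≤ (Q₁.dist n).toOuterMeasure {x | f x n ∈ B₂ (κ ℓ ℓ')} :=
            (Q₁.dist n).toOuterMeasure.mono hsub
        _ ≤ ((p.eval n : ℕ) : ℝ≥0∞) * (Q₂.dist n').toOuterMeasure (B₂ (κ ℓ ℓ')) :=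
            toOuterMeasure_setOf_apply_mem_le_of_dominated hdom n _
        _ ≤ ((p.eval n : ℕ) : ℝ≥0∞) * ((κ ℓ ℓ' : ℕ) : ℝ≥0∞)⁻¹ := by
            gcongr
            exact toOuterMeasure_le_inv_of_prob_le hκpos (hbad n' (κ ℓ ℓ') hκpos)
        _ ≤ _ := mul_inv_le_of_padParam_ge hκx
    · have hempty : S ℓ ℓ' = ∅ := by
        refine Set.eq_empty_of_forall_notMem fun x hx => hne ⟨x, hx.1, hx.2.1⟩
      rw [hempty, MeasureTheory.measure_empty]
      exact bot_le
  -- Step 3: sum up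
  have htotal : (Q₁.dist n).toOuterMeasure B' ≤ (((k + 1 : ℕ)) : ℝ≥0∞)⁻¹ := by
    calc (Q₁.dist n).toOuterMeasure B'
        ≤ (Q₁.dist n).toOuterMeasure (⋃ ℓ, ⋃ ℓ', S ℓ ℓ') := PMF.toOuterMeasure_mono _ hcover
      _ ≤ ∑' ℓ, (Q₁.dist n).toOuterMeasure (⋃ ℓ', S ℓ ℓ') := MeasureTheory.measure_iUnion_le _
      _ ≤ ∑' ℓ, ∑' ℓ', (Q₁.dist n).toOuterMeasure (S ℓ ℓ') :=
          ENNReal.tsum_le_tsum fun ℓ => MeasureTheory.measure_iUnion_le _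
      _ ≤ ∑' ℓ : ℕ, ∑' ℓ' : ℕ, (((ℓ + k + 1) * (ℓ + k + 2) : ℕ) : ℝ≥0∞)⁻¹ *
            (((ℓ' + 1) * (ℓ' + 2) : ℕ) : ℝ≥0∞)⁻¹ :=
          ENNReal.tsum_le_tsum fun ℓ => ENNReal.tsum_le_tsum fun ℓ' => hpiece ℓ ℓ'
      _ = (∑' ℓ : ℕ, (((ℓ + k + 1) * (ℓ + k + 2) : ℕ) : ℝ≥0∞)⁻¹) *
            ∑' ℓ' : ℕ, (((ℓ' + 1) * (ℓ' + 2) : ℕ) : ℝ≥0∞)⁻¹ := by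
          rw [← ENNReal.tsum_mul_right]
          exact tsum_congr fun ℓ => ENNReal.tsum_mul_left
      _ ≤ (((k + 1 : ℕ)) : ℝ≥0∞)⁻¹ * (((0 + 1 : ℕ)) : ℝ≥0∞)⁻¹ := by
          gcongr
          · exact tsum_inv_mul_succ_le k
          · have h := tsum_inv_mul_succ_le 0
            simpa using h
      _ = (((k + 1 : ℕ)) : ℝ≥0∞)⁻¹ := by simp
  -- Step 4: back to real numbers
  change ((Q₁.dist n).toOuterMeasure B').toReal ≤ 1 / k
  refine ENNReal.toReal_le_of_le_ofReal (by positivity) (htotal.trans ?_)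
  rw [one_div, ENNReal.ofReal_inv_of_pos (by exact_mod_cast hk), ENNReal.ofReal_natCast]
  gcongr
  exact_mod_cast Nat.le_succ k

end Literature.Computability.MetaComplexity
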